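import Mathlib
import HarnessLib
import Literature.Analysis.FluidPDE.MildAncientTimeDecayRegularity
import Summits.NavierStokesRegularity.NavierStokesRegularity.Theorems.PoloidalWindowDoorPoloidalWindowRigidityHotHullCompactness
import Summits.NavierStokesRegularity.NavierStokesRegularity.Theorems.PoloidalWindowDoorPoloidalWindowRigidityHotHullSliding
import Summits.NavierStokesRegularity.NavierStokesRegularity.Theorems.PoloidalWindowDoorLrcModEntireRidgeHullTools
import Summits.NavierStokesRegularity.NavierStokesRegularity.Theorems.PoloidalWindowDoorLrcModEntireRidgeBranchCurvature
import Summits.NavierStokesRegularity.NavierStokesRegularity.Theorems.PoloidalWindowDoorLrcModEntireRidgeClass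

/-!
# Item `LrcModEntire` (stmt-NavierStokesRegularity-20428) — (Q3) THE HULL STEP AT CLASS LEVEL: a hull limit along a complete regular hot branch carries the
# LIMIT BRANCH, hot and critical, with the limits of the second-order ridge data; a convergent ridge functional is CONSTANT on it

ns-k2-port-2 g5 (helper prover under the LEAD of item 20428, ns-poloidal-K2-p3 g14; `--supports stmt-NavierStokesRegularity-20428 --as helper`).
Memo `Cruxes/LrcModEntire/T2B-g14.md` §10 «(Q3) HULL STATEMENT», in the currency of the LEAD's `…LrcModEntireRidgeClass` (class clauses and Peakless
unfolded as in ns-poloidal-K2-p2's `…HotHullCompactness.hullLimit`; `f = σ·v₂(−1,·)` on `ℝ³`; a hot branch `γ : ℝ → P₀ = {y₂ = 0}` of Euclidean unit speed with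
in-plane unit normal `ν s = (−(γ′ s)₁, (γ′ s)₀, 0)`; ridge data by the nested-`fderiv` defining equations `κ = −D²f(γ)(ν,ν)`, `α = D²f(γ)(ν,e_z)`, `β = D²f(γ)(e_z,e_z)`).

* `exists_hullLimit_branch` — **THE HULL STEP.**  Pinned + Peakless class profile `v` with critical hot set; a COMPLETE `C²` hot branch `γ` (all `s ∈ ℝ`; in the (TH)
  column hot webs have no vertices once `κ > 0`, `…RidgeBranchCurvature.hessian_eq_zero_of_two_branches`) which is UNIFORMLY NON-DEGENERATE,
  `−D²f(γ s)(ν s, ν s) ≥ κ₀ > 0`; ANY base points `s_k` (for the homogenisation, `s_k → +∞`).  Then along a subsequence `φ`: the re-pinned translates `v(·, · + γ(s_{φ k}))` converge (slice-wise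
  locally uniformly) to a pinned peakless `U` with the same hot value (`hullLimit`); the re-based branches `γ(s_{φ k} + ·) − γ(s_{φ k})` converge ON ALL OF `ℝ`,
  with first derivatives, to a `C¹` unit-speed curve `Γ ⊂ P₀`, `Γ 0 = 0`, `Γ′` Lipschitz (curvature `≤ C₃/κ₀` by `…RidgeBranchCurvature` + Arzelà–Ascoli
  `…RidgeHullTools.exists_tendsto_rebased_curves`); `Γ` is HOT and CRITICAL for `U`; and the second derivatives of `σ·v₂(−1,·)` at `γ(s_{φ k}+s)` along ANY
  convergent directions converge to those of `σ·U₂(−1,·)` at `Γ s` (all jets converge: (F1) orderwise bounds + `…RidgeHullTools` T0/T2).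
* `ridgeData_tendsto_of_hullLimit_branch` — in particular `κ`, `α`, `β` at `γ(s_{φ k}+s)` converge to `κ_U`, `α_U`, `β_U` at `Γ s` (normals converge with `γ′`), and
  `κ_U ≥ κ₀`.
* `ridgeCoeff_eq_of_tendsto` — **HOMOGENISATION**: if `s ↦ α(s)²/κ(s) + β(s) → L` at `+∞` (e.g. bounded and quasiconvex on a half-line — `…RidgeAssembly` /
  `…RidgeClass` + `…TwistingTHRidgeQuasiconvexTools.exists_tendsto_atTop_of_abs_le`), then `α_U(Γ s)²/κ_U(Γ s) + β_U(Γ s) = L` for EVERY `s ∈ ℝ` (`…RidgeHullTools.eq_lim_of_tendsto_shift`).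

WHAT THIS IS NOT: not a claim about Navier–Stokes regularity — the hull bookkeeping of the «ridge quasiconvexity» lever on the research stubs `stub_T2b` / `stub_C2a'` /
`stub_C2b'` (bears_on LADDER-NS N0, item 20428 / crux 19708; 20428/19708/27893 OPEN); the research cell (Q4) «HOMOGENEOUS NULL RIDGE» stays OPEN.  No summit statement is proved here.
-/

noncomputable section

-- the summit and its single sub-problem share the name (CONVENTIONS §1), as in every Theorems file
set_option linter.dupNamespace false

namespace Summit.NavierStokesRegularity.NavierStokesRegularity.Theorems.PoloidalWindowDoorLrcModEntireRidgeHull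

open Set Filter Topology Metric Function
open scoped ContDiff InnerProductSpace RealInnerProductSpace Laplacian
open Literature.Analysis Literature.Analysis.FluidPDE
open Summit.NavierStokesRegularity.NavierStokesRegularity.Theorems.LocalSineTubeDoorProfileAlignedWindowRigidityAncient
open Summit.NavierStokesRegularity.NavierStokesRegularity.Theorems.PoloidalWindowDoorPoloidalWindowRigidityHotHullCompactness
open Summit.NavierStokesRegularity.NavierStokesRegularity.Theorems.PoloidalWindowDoorPoloidalWindowRigidityHotHullSliding
open Summit.NavierStokesRegularity.NavierStokesRegularity.Theorems.PoloidalWindowDoorLrcModEntireRidgeHullTools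
open Summit.NavierStokesRegularity.NavierStokesRegularity.Theorems.PoloidalWindowDoorLrcModEntireRidgeBranchCurvature
open Summit.NavierStokesRegularity.NavierStokesRegularity.Theorems.PoloidalWindowDoorLrcModEntireRidgeClass

/-! ### Small generic facts -/

/-- The in-plane normal map `u ↦ (−u₁, u₀, 0)` of `ℝ³` is continuous. [folklore] -/
theorem continuous_planeNormal :
    Continuous fun u : EuclideanSpace ℝ (Fin 3) => (WithLp.toLp 2 ![-(u 1), u 0, 0] : EuclideanSpace ℝ (Fin 3)) := by
  refine (PiLp.continuous_toLp 2 _).comp (continuous_pi fun i => ?_)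
  fin_cases i <;> simp <;> fun_prop

variable {C : ℝ} {v : ℝ → EuclideanSpace ℝ (Fin 3) → EuclideanSpace ℝ (Fin 3)}

/-- The signed vertical slice `σ·u₂` of a smooth field is smooth. -/
theorem contDiff_signed {u : EuclideanSpace ℝ (Fin 3) → EuclideanSpace ℝ (Fin 3)} (hu : ContDiff ℝ ∞ u) (σ : ℝ) :
    ContDiff ℝ ∞ fun y => σ * u y 2 :=
  contDiff_const.mul ((contDiff_piLp_apply (p := 2) (𝕜 := ℝ) (E := fun _ : Fin 3 => ℝ) (i := (2 : Fin 3))).comp hu)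

/-! ### The hull step -/

/-- **(Q3) THE HULL STEP: a hull limit along a complete, uniformly non-degenerate hot branch carries the limit branch, hot and critical, with the limits of all
second-order data.**  See the module docstring.  Hypotheses: class clauses + Peakless exactly as in `…HotHullCompactness.hullLimit`; critical hot set as in
`…RidgeClass`; the branch `γ` and arbitrary base parameters `sq k`. -/
theorem exists_hullLimit_branch (C : ℝ) (v : ℝ → EuclideanSpace ℝ (Fin 3) → EuclideanSpace ℝ (Fin 3))
    (hP : (Literature.Analysis.FluidPDE.HasTypeITimeDecay C v ∧
        ContinuousOn (Function.uncurry v) (Set.Iio (0 : ℝ) ×ˢ Set.univ) ∧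
        (∀ s t : ℝ, s < t → t < 0 → ∀ x, v t x =
          Literature.Analysis.UnboundedOperators.heatExtension (v s) (t - s) x -
            Literature.Analysis.FluidPDE.oseenDuhamel 1 s v v t x) ∧
        (∀ t < 0, Literature.Analysis.FluidPDE.VectorCalculus.IsDivFree (v t)) ∧
        (∀ s < 0, ∀ q, ⟪Literature.Analysis.FluidPDE.curl (v s) q, EuclideanSpace.single 2 1⟫_ℝ = 0) ∧
        v (-1) 0 2 ≠ 0 ∧ (∀ t < 0, ∀ x, Real.sqrt (-t) * |v t x 2| ≤ |v (-1) 0 2|) ∧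
        (∀ h : EuclideanSpace ℝ (Fin 3), fderiv ℝ (v (-1)) 0 h 2 = 0) ∧
        (deriv (fun s => v s 0 2) (-1) = v (-1) 0 2 / 2 ∧ v (-1) 0 2 * (Δ (fun q => v (-1) q 2)) 0 ≤ 0)))
    (hK : (∀ (s z₀ σ M : ℝ) (K O : Set (EuclideanSpace ℝ (Fin 3))), s < 0 →
        ((σ = 1 ∨ σ = -1) ∧ IsCompact K ∧ K.Nonempty ∧ (∀ q ∈ K, q 2 = z₀ ∧ σ * v s q 2 = M) ∧
          IsOpen O ∧ K ⊆ O ∧ (∀ q ∈ O, q 2 = z₀ → σ * v s q 2 ≤ M) ∧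
          (∀ q ∈ O, q 2 = z₀ → σ * v s q 2 = M → q ∈ K)) → False))
    (hcrit : ∀ y ∈ {y : EuclideanSpace ℝ (Fin 3) | y 2 = 0 ∧ v (-1) y 2 = v (-1) 0 2}, fderiv ℝ (fun x => v (-1) x 2) y = 0)
    {σ : ℝ} (hσ : σ = 1 ∨ σ = -1)
    {γ : ℝ → EuclideanSpace ℝ (Fin 3)} (hγ2 : ContDiff ℝ 2 γ) (hplane : ∀ s, γ s 2 = 0) (hunit : ∀ s, ‖deriv γ s‖ = 1)
    (hhot : ∀ s, v (-1) (γ s) 2 = v (-1) 0 2)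
    {ν : ℝ → EuclideanSpace ℝ (Fin 3)} (hν : ∀ s, ν s = WithLp.toLp 2 ![-(deriv γ s 1), deriv γ s 0, 0])
    {κ₀ : ℝ} (hκ₀ : 0 < κ₀) (hκ : ∀ s, κ₀ ≤ -(fderiv ℝ (fderiv ℝ (fun y => σ * v (-1) y 2)) (γ s) (ν s) (ν s)))
    (sq : ℕ → ℝ) :
    ∃ (φ : ℕ → ℕ) (U : ℝ → EuclideanSpace ℝ (Fin 3) → EuclideanSpace ℝ (Fin 3)) (Γ : ℝ → EuclideanSpace ℝ (Fin 3)), StrictMono φ ∧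
      -- the hull limit (pinned, peakless, same hot value), slices converging locally uniformly
      (Literature.Analysis.FluidPDE.HasTypeITimeDecay C U ∧
        ContinuousOn (Function.uncurry U) (Set.Iio (0 : ℝ) ×ˢ Set.univ) ∧
        (∀ s t : ℝ, s < t → t < 0 → ∀ x, U t x =
          Literature.Analysis.UnboundedOperators.heatExtension (U s) (t - s) x -
            Literature.Analysis.FluidPDE.oseenDuhamel 1 s U U t x) ∧
        (∀ t < 0, Literature.Analysis.FluidPDE.VectorCalculus.IsDivFree (U t)) ∧
        (∀ s < 0, ∀ q, ⟪Literature.Analysis.FluidPDE.curl (U s) q, EuclideanSpace.single 2 1⟫_ℝ = 0) ∧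
        U (-1) 0 2 ≠ 0 ∧ (∀ t < 0, ∀ x, Real.sqrt (-t) * |U t x 2| ≤ |U (-1) 0 2|) ∧
        (∀ h : EuclideanSpace ℝ (Fin 3), fderiv ℝ (U (-1)) 0 h 2 = 0) ∧
        (deriv (fun s => U s 0 2) (-1) = U (-1) 0 2 / 2 ∧ U (-1) 0 2 * (Δ (fun q => U (-1) q 2)) 0 ≤ 0)) ∧
      (∀ (s z₀ σ M : ℝ) (K O : Set (EuclideanSpace ℝ (Fin 3))), s < 0 →
        ((σ = 1 ∨ σ = -1) ∧ IsCompact K ∧ K.Nonempty ∧ (∀ q ∈ K, q 2 = z₀ ∧ σ * U s q 2 = M) ∧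
          IsOpen O ∧ K ⊆ O ∧ (∀ q ∈ O, q 2 = z₀ → σ * U s q 2 ≤ M) ∧
          (∀ q ∈ O, q 2 = z₀ → σ * U s q 2 = M → q ∈ K)) → False) ∧
      U (-1) 0 2 = v (-1) 0 2 ∧
      (∀ t < 0, TendstoLocallyUniformly (fun j x => v t (x + γ (sq (φ j)))) (U t) atTop) ∧
      -- the limit branch
      ContDiff ℝ 1 Γ ∧ Γ 0 = 0 ∧ (∀ s, Γ s 2 = 0) ∧ (∀ s, ‖deriv Γ s‖ = 1) ∧ (∃ B, LipschitzWith B (deriv Γ)) ∧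
      (∀ s, Tendsto (fun j => γ (sq (φ j) + s) - γ (sq (φ j))) atTop (𝓝 (Γ s))) ∧
      (∀ s, Tendsto (fun j => deriv γ (sq (φ j) + s)) atTop (𝓝 (deriv Γ s))) ∧
      (∀ s, Tendsto (fun j => ν (sq (φ j) + s)) atTop (𝓝 (WithLp.toLp 2 ![-(deriv Γ s 1), deriv Γ s 0, 0]))) ∧
      -- hot and critical for the limit
      (∀ s, U (-1) (Γ s) 2 = U (-1) 0 2) ∧ (∀ s, fderiv ℝ (fun x => U (-1) x 2) (Γ s) = 0) ∧
      -- second-order data converge along any convergent directions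
      (∀ s, ∀ (m₁ m₂ : ℕ → EuclideanSpace ℝ (Fin 3)) (l₁ l₂ : EuclideanSpace ℝ (Fin 3)),
        Tendsto m₁ atTop (𝓝 l₁) → Tendsto m₂ atTop (𝓝 l₂) →
        Tendsto (fun j => fderiv ℝ (fderiv ℝ (fun y => σ * v (-1) y 2)) (γ (sq (φ j) + s)) (m₁ j) (m₂ j)) atTop
          (𝓝 (fderiv ℝ (fderiv ℝ (fun y => σ * U (-1) y 2)) (Γ s) l₁ l₂))) := by
  obtain ⟨hrate, hcont, hmild, hdivf, hpol, hN, hpin, hgrad0, hpins⟩ := hP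
  have hneg : (-1 : ℝ) < 0 := by norm_num
  -- ## the slice, its jets (F1), the signed slice `f`
  have hslice : ContDiff ℝ ∞ (v (-1)) := (analyticOnNhd_slice hcont (bdd_of_hasTypeITimeDecay hrate) hmild hneg).contDiff
  have hwdiv : ∀ t < 0, IsWeaklyDivFree (v t) := fun t ht =>
    VectorCalculus.IsDivFree.isWeaklyDivFree_holds (hdivf t ht)
      ((analyticOnNhd_slice hcont (bdd_of_hasTypeITimeDecay hrate) hmild ht).contDiff (n := 1))
  have hF1 : ∀ k : ℕ, ∃ K : ℝ, ∀ y, ‖iteratedFDeriv ℝ k (v (-1)) y‖ ≤ K := fun k =>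
    exists_norm_iteratedFDeriv_le_slice_of_hasTypeITimeDecay hrate hcont hmild hwdiv hneg k
  set f : EuclideanSpace ℝ (Fin 3) → ℝ := fun y => σ * v (-1) y 2 with hfdef
  have hf : ContDiff ℝ ∞ f := contDiff_signed hslice σ
  obtain ⟨C₃, hC₃v⟩ := hF1 3
  have hC₃ : ∀ x, ‖iteratedFDeriv ℝ 3 f x‖ ≤ C₃ := fun x => (norm_iteratedFDeriv_signed_le hslice hσ 3 x).trans (hC₃v x)
  -- criticality of `f` along the branch
  have hv2d : Differentiable ℝ (fun y => v (-1) y 2) :=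
    ((contDiff_piLp_apply (p := 2) (𝕜 := ℝ) (E := fun _ : Fin 3 => ℝ) (i := (2 : Fin 3))).comp hslice).differentiable (by simp)
  have hfcrit : ∀ s, fderiv ℝ f (γ s) = 0 := by
    intro s
    have h0 := hcrit (γ s) ⟨hplane s, hhot s⟩
    have h1 : HasFDerivAt (fun y => σ • v (-1) y 2) (σ • fderiv ℝ (fun x => v (-1) x 2) (γ s)) (γ s) :=
      (hv2d _).hasFDerivAt.const_smul σ
    rw [h0, smul_zero] at h1
    rw [hfdef, show (fun y => σ * v (-1) y 2) = fun y => σ • (v (-1) y 2) from rfl]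
    exact h1.fderiv
  -- ## curvature of the branch
  have hγd : Differentiable ℝ γ := hγ2.differentiable (by norm_num)
  have hγ'd : Differentiable ℝ (deriv γ) := hγ2.differentiable_deriv_two
  have hB : ∀ s, ‖iteratedDeriv 2 γ s‖ ≤ C₃ / κ₀ :=
    norm_iteratedDeriv_two_le_of_critical_planeBranch (hf.of_le (by exact WithTop.coe_le_coe.2 le_top)) le_rfl hγ2 hplane hunit hfcrit hν hκ₀
      (fun s => by linarith [hκ s]) (fun s => hC₃ (γ s))
  -- ## the hull limit along the hot points `γ (sq k)`
  obtain ⟨φ₁, U, hφ₁, hPU, hKU, hconv, -⟩ :=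
    hullLimit C v ⟨hrate, hcont, hmild, hdivf, hpol, hN, hpin, hgrad0, hpins⟩ hK (fun k => γ (sq k)) (fun k => ⟨hplane _, hhot _⟩)
  -- ## compactness of the re-based branches along `φ₁`
  set γr : ℕ → ℝ → EuclideanSpace ℝ (Fin 3) := fun k s => γ (sq (φ₁ k) + s) - γ (sq (φ₁ k)) with hγr
  have hγr2 : ∀ k, ContDiff ℝ 2 (γr k) := fun k =>
    (hγ2.comp (contDiff_const.add contDiff_id)).sub contDiff_const
  have hγr0 : ∀ k, γr k 0 = 0 := fun k => by simp [hγr]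
  have hγr_deriv : ∀ k, deriv (γr k) = fun s => deriv γ (sq (φ₁ k) + s) := by
    intro k; funext s
    have h1 : deriv (fun s => γ (sq (φ₁ k) + s) - γ (sq (φ₁ k))) s = deriv (fun s => γ (sq (φ₁ k) + s)) s := by
      rw [deriv_sub_const]
    rw [show γr k = fun s => γ (sq (φ₁ k) + s) - γ (sq (φ₁ k)) from rfl, h1]
    exact deriv_comp_const_add γ (sq (φ₁ k)) s
  have hγr_dd : ∀ k, iteratedDeriv 2 (γr k) = fun s => iteratedDeriv 2 γ (sq (φ₁ k) + s) := by
    intro k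
    rw [iteratedDeriv_succ, iteratedDeriv_one, iteratedDeriv_succ, iteratedDeriv_one, hγr_deriv k]
    funext s
    exact deriv_comp_const_add (deriv γ) (sq (φ₁ k)) s
  have hL : ∀ k s, ‖deriv (γr k) s‖ ≤ 1 := fun k s => by rw [hγr_deriv k]; exact (hunit _).le
  have hBr : ∀ k s, ‖iteratedDeriv 2 (γr k) s‖ ≤ C₃ / κ₀ := fun k s => by rw [hγr_dd k]; exact hB _
  obtain ⟨Γ, φ₂, hφ₂, hΓ1, hΓ0, hcγ, hcγ', hLip⟩ := exists_tendsto_rebased_curves hγr2 hγr0 hL hBr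
  -- the combined subsequence
  set φ : ℕ → ℕ := φ₁ ∘ φ₂ with hφdef
  have hφ : StrictMono φ := hφ₁.comp hφ₂
  have hconvφ : ∀ t < 0, TendstoLocallyUniformly (fun j x => v t (x + γ (sq (φ j)))) (U t) atTop := fun t ht u hu x => by
    -- a subsequence of a locally uniformly convergent sequence (cf. `…OSWSelfSimilar…tendstoLocallyUniformly_subseq`)
    obtain ⟨w, hw, hev⟩ := (hconv t ht) u hu x
    exact ⟨w, hw, hφ₂.tendsto_atTop.eventually hev⟩
  -- pointwise forms of the branch convergence
  have hptγ : ∀ s, Tendsto (fun j => γ (sq (φ j) + s) - γ (sq (φ j))) atTop (𝓝 (Γ s)) := fun s =>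
    (tendstoLocallyUniformlyOn_univ.2 hcγ).tendsto_at (mem_univ s)
  have hptγ' : ∀ s, Tendsto (fun j => deriv γ (sq (φ j) + s)) atTop (𝓝 (deriv Γ s)) := fun s => by
    have h := (tendstoLocallyUniformlyOn_univ.2 hcγ').tendsto_at (mem_univ s)
    simp only [hγr_deriv] at h
    exact h
  have hptν : ∀ s, Tendsto (fun j => ν (sq (φ j) + s)) atTop (𝓝 (WithLp.toLp 2 ![-(deriv Γ s 1), deriv Γ s 0, 0])) := fun s => by
    have h := (continuous_planeNormal.tendsto (deriv Γ s)).comp (hptγ' s)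
    have e : (fun j => ν (sq (φ j) + s)) =
        (fun u : EuclideanSpace ℝ (Fin 3) => (WithLp.toLp 2 ![-(u 1), u 0, 0] : EuclideanSpace ℝ (Fin 3))) ∘ fun j => deriv γ (sq (φ j) + s) := by
      funext j; simp only [Function.comp_apply, hν]
    rw [e]; exact h
  -- ## properties of `Γ`
  have hΓplane : ∀ s, Γ s 2 = 0 := fun s => by
    have h := ((EuclideanSpace.proj (𝕜 := ℝ) (2 : Fin 3)).continuous.tendsto _).comp (hptγ s)
    have e : (fun j => (γ (sq (φ j) + s) - γ (sq (φ j))) 2) = fun _ => (0 : ℝ) := by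
      funext j; simp [hplane]
    have h' : Tendsto (fun j => (γ (sq (φ j) + s) - γ (sq (φ j))) 2) atTop (𝓝 (Γ s 2)) := h
    rw [e] at h'
    exact (tendsto_nhds_unique h' tendsto_const_nhds)
  have hΓunit : ∀ s, ‖deriv Γ s‖ = 1 := norm_eq_of_tendstoLocallyUniformly hcγ' (fun k s => by rw [hγr_deriv]; exact hunit _)
  -- ## the signed slices of the translates and of the limit; all jets converge (T0)
  set fj : ℕ → EuclideanSpace ℝ (Fin 3) → ℝ := fun j y => σ * v (-1) (y + γ (sq (φ j))) 2 with hfj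
  set fU : EuclideanSpace ℝ (Fin 3) → ℝ := fun y => σ * U (-1) y 2 with hfU
  have hfj_eq : ∀ j, fj j = fun y => f (y + γ (sq (φ j))) := fun j => rfl
  have hUc : Continuous (U (-1)) := continuous_slice_of_class hPU.1 hPU.2.1 hPU.2.2.1 hPU.2.2.2.1 hneg
  have hfU_lim : TendstoLocallyUniformlyOn fj fU atTop univ := by
    rw [tendstoLocallyUniformlyOn_univ]
    have h2 : UniformContinuous fun x : EuclideanSpace ℝ (Fin 3) => σ * x 2 := by
      have : (fun x : EuclideanSpace ℝ (Fin 3) => σ * x 2) = ⇑(σ • EuclideanSpace.proj (𝕜 := ℝ) (2 : Fin 3)) := by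
        funext x; simp
      rw [this]; exact (σ • EuclideanSpace.proj (𝕜 := ℝ) (2 : Fin 3)).uniformContinuous
    exact h2.comp_tendstoLocallyUniformly (hconvφ (-1) hneg)
  have hfj_smooth : ∀ j, ContDiffOn ℝ ∞ (fj j) univ := fun j => by
    rw [hfj_eq]; exact (hf.comp (contDiff_id.add contDiff_const)).contDiffOn
  have hfj_bd : ∀ (i : ℕ), ∀ K ⊆ (univ : Set (EuclideanSpace ℝ (Fin 3))), IsCompact K →
      ∃ Λ : ℝ, ∀ n, ∀ z ∈ K, ‖iteratedFDeriv ℝ i (fj n) z‖ ≤ Λ := by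
    intro i K _ _
    obtain ⟨Λ, hΛ⟩ := hF1 i
    refine ⟨Λ, fun n z _ => ?_⟩
    rw [hfj_eq, iteratedFDeriv_comp_add_right]
    exact (norm_iteratedFDeriv_signed_le hslice hσ i _).trans (hΛ _)
  obtain ⟨hfU_smooth, hjets⟩ :=
    contDiffOn_and_tendsto_iteratedFDeriv_of_tendstoLocallyUniformlyOn isOpen_univ hfj_smooth hfj_bd hfU_lim
  have hfUcont : ∀ i, ContinuousOn (iteratedFDeriv ℝ i fU) univ := continuousOn_iteratedFDeriv_of_contDiffOn isOpen_univ hfU_smooth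
  -- base points in the translated frames: `γ(sq(φ j)+s) − γ(sq(φ j)) → Γ s`
  -- ## hot
  have hΓhot : ∀ s, U (-1) (Γ s) 2 = U (-1) 0 2 := by
    intro s
    have hV : TendstoLocallyUniformly (fun j x => v (-1) (x + γ (sq (φ j)))) (U (-1)) atTop := hconvφ (-1) hneg
    -- value at the moving base points
    have h1 : Tendsto (fun j => v (-1) ((γ (sq (φ j) + s) - γ (sq (φ j))) + γ (sq (φ j)))) atTop (𝓝 (U (-1) (Γ s))) :=
      hV.tendsto_comp hUc.continuousAt (hptγ s)
    have h1' : Tendsto (fun j => v (-1) ((γ (sq (φ j) + s) - γ (sq (φ j))) + γ (sq (φ j))) 2) atTop (𝓝 (U (-1) (Γ s) 2)) :=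
      ((EuclideanSpace.proj (𝕜 := ℝ) (2 : Fin 3)).continuous.tendsto _).comp h1
    have e1 : (fun j => v (-1) ((γ (sq (φ j) + s) - γ (sq (φ j))) + γ (sq (φ j))) 2) = fun _ => v (-1) 0 2 := by
      funext j; rw [sub_add_cancel, hhot]
    rw [e1] at h1'
    have hval : U (-1) (Γ s) 2 = v (-1) 0 2 := tendsto_nhds_unique h1' tendsto_const_nhds
    -- and at `0`
    have h0 : Tendsto (fun j => v (-1) ((0 : EuclideanSpace ℝ (Fin 3)) + γ (sq (φ j))) 2) atTop (𝓝 (U (-1) 0 2)) :=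
      ((EuclideanSpace.proj (𝕜 := ℝ) (2 : Fin 3)).continuous.tendsto _).comp ((tendstoLocallyUniformlyOn_univ.2 hV).tendsto_at (mem_univ 0))
    have e0 : (fun j => v (-1) ((0 : EuclideanSpace ℝ (Fin 3)) + γ (sq (φ j))) 2) = fun _ => v (-1) 0 2 := by
      funext j; rw [zero_add, hhot]
    rw [e0] at h0
    rw [hval, (tendsto_nhds_unique h0 tendsto_const_nhds)]
  have hUN : U (-1) 0 2 = v (-1) 0 2 := by
    have hV := hconvφ (-1) hneg
    have h0 : Tendsto (fun j => v (-1) ((0 : EuclideanSpace ℝ (Fin 3)) + γ (sq (φ j))) 2) atTop (𝓝 (U (-1) 0 2)) :=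
      ((EuclideanSpace.proj (𝕜 := ℝ) (2 : Fin 3)).continuous.tendsto _).comp ((tendstoLocallyUniformlyOn_univ.2 hV).tendsto_at (mem_univ 0))
    have e0 : (fun j => v (-1) ((0 : EuclideanSpace ℝ (Fin 3)) + γ (sq (φ j))) 2) = fun _ => v (-1) 0 2 := by
      funext j; rw [zero_add, hhot]
    rw [e0] at h0
    exact tendsto_nhds_unique h0 tendsto_const_nhds
  -- ## second-order data (T2 with `i = 2`)
  have hsecond : ∀ s, ∀ (m₁ m₂ : ℕ → EuclideanSpace ℝ (Fin 3)) (l₁ l₂ : EuclideanSpace ℝ (Fin 3)),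
      Tendsto m₁ atTop (𝓝 l₁) → Tendsto m₂ atTop (𝓝 l₂) →
      Tendsto (fun j => fderiv ℝ (fderiv ℝ (fun y => σ * v (-1) y 2)) (γ (sq (φ j) + s)) (m₁ j) (m₂ j)) atTop
        (𝓝 (fderiv ℝ (fderiv ℝ (fun y => σ * U (-1) y 2)) (Γ s) l₁ l₂)) := by
    intro s m₁ m₂ l₁ l₂ hm₁ hm₂
    have hm : Tendsto (fun j => (![m₁ j, m₂ j] : Fin 2 → EuclideanSpace ℝ (Fin 3))) atTop (𝓝 ![l₁, l₂]) := by
      rw [tendsto_pi_nhds]; intro i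
      fin_cases i
      · simpa using hm₁
      · simpa using hm₂
    have h := tendsto_iteratedFDeriv_apply isOpen_univ (hjets 2) (hfUcont 2) (mem_univ (Γ s)) (hptγ s) hm
    have e : ∀ j, iteratedFDeriv ℝ 2 (fj j) (γ (sq (φ j) + s) - γ (sq (φ j))) ![m₁ j, m₂ j] =
        fderiv ℝ (fderiv ℝ f) (γ (sq (φ j) + s)) (m₁ j) (m₂ j) := by
      intro j
      rw [hfj_eq, iteratedFDeriv_comp_add_right, sub_add_cancel, iteratedFDeriv_two_apply]
      rfl
    simp only [e] at h
    rw [iteratedFDeriv_two_apply] at h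
    exact h
  -- ## critical (T2 with `i = 1`)
  have hΓcrit : ∀ s, fderiv ℝ (fun x => U (-1) x 2) (Γ s) = 0 := by
    intro s
    have hfUcrit : fderiv ℝ fU (Γ s) = 0 := by
      ext m
      have hm : Tendsto (fun _ : ℕ => (![m] : Fin 1 → EuclideanSpace ℝ (Fin 3))) atTop (𝓝 ![m]) := tendsto_const_nhds
      have h := tendsto_iteratedFDeriv_apply isOpen_univ (hjets 1) (hfUcont 1) (mem_univ (Γ s)) (hptγ s) hm
      have e : ∀ j, iteratedFDeriv ℝ 1 (fj j) (γ (sq (φ j) + s) - γ (sq (φ j))) ![m] = 0 := by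
        intro j
        rw [hfj_eq, iteratedFDeriv_comp_add_right, sub_add_cancel, iteratedFDeriv_one_apply, hfcrit]
        rfl
      simp only [e] at h
      rw [iteratedFDeriv_one_apply] at h
      have : fderiv ℝ fU (Γ s) ((![m] : Fin 1 → EuclideanSpace ℝ (Fin 3)) 0) = 0 := tendsto_nhds_unique h tendsto_const_nhds
      simpa using this
    -- unsign
    have hUd : DifferentiableAt ℝ (fun y => U (-1) y 2) (Γ s) := by
      have hU2 : ContDiff ℝ ∞ fU := by rw [← contDiffOn_univ]; exact hfU_smooth
      have : (fun y => U (-1) y 2) = fun y => σ * fU y := by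
        funext y; rcases hσ with h | h <;> simp [hfU, h]
      rw [this]
      exact ((contDiff_const.mul hU2).differentiable (by simp)) _
    have h1 : HasFDerivAt (fun y => σ • U (-1) y 2) (σ • fderiv ℝ (fun x => U (-1) x 2) (Γ s)) (Γ s) :=
      hUd.hasFDerivAt.const_smul σ
    have h2 : fderiv ℝ fU (Γ s) = σ • fderiv ℝ (fun x => U (-1) x 2) (Γ s) := by
      rw [hfU, show (fun y => σ * U (-1) y 2) = fun y => σ • (U (-1) y 2) from rfl]; exact h1.fderiv
    rw [hfUcrit] at h2
    have hσ0 : σ ≠ 0 := by rcases hσ with h | h <;> simp [h]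
    exact (smul_eq_zero.1 h2.symm).resolve_left hσ0
  exact ⟨φ, U, Γ, hφ, hPU, hKU, hUN, hconvφ, hΓ1, hΓ0, hΓplane, hΓunit, ⟨_, hLip⟩, hptγ, hptγ', hptν, hΓhot, hΓcrit, hsecond⟩

end Summit.NavierStokesRegularity.NavierStokesRegularity.Theorems.PoloidalWindowDoorLrcModEntireRidgeHull

end
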